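import Mathlib.Analysis.Calculus.ParametricIntegral
import Mathlib.MeasureTheory.Integral.DominatedConvergence
import Mathlib.Analysis.SpecialFunctions.Gaussian.FourierTransform
import Literature.Analysis.FluidPDE.AdaptedBackwardKernel
import Literature.Analysis.FluidPDE.WholeSpaceIBP
import Literature.Analysis.FluidPDE.SpaceTimeCalculus
import Literature.Analysis.FluidPDE.SpaceTimeCalculusC1
import Literature.Analysis.FluidPDE.SlicePressureIdentity
import Literature.Analysis.FluidPDE.MildSolutionProofs
import Literature.Analysis.FluidPDE.HessianLaplacian
import HarnessLib

/-!
# Crux `FrequencyRigidity` (stmt-NavierStokesRegularity-2955), line `two-ended-pinning`: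
  helper lemmas for STUB `stub_kernelPairing` (the kernel calculus of an adapted backward kernel)

Helper file (lands `--supports stmt-NavierStokesRegularity-2955`) for the registered stub
`stub_kernelPairing` of the line's skeleton. Everything here is PURE KERNEL CALCULUS (no
Navier–Stokes), for a general finite-dimensional real inner product space `E` with its Lebesgue
measure:

* `kernelPairing_integral_mul_fderiv_apply_eq_neg`: transport integration by parts against a
  divergence-free drift, `∫ p · DK(V) = -∫ Dp(V) · K` for `p ∈ C¹_c`, `K, V ∈ C¹`, `div V = 0`
  (the divergence theorem without boundary of the tree, `integral_divergence_eq_zero`);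
* `kernelPairing_hasDerivAt_kernel`: at interior times an adapted backward kernel of
  `∂ₜ + v·∇ − νΔ` (`IsAdaptedBackwardKernel`, Friedman 1964, Ch. 1 §8) has the two-sided time
  derivative `∂ₜK = −(DK·v + νΔK)` (the adjoint equation);
* `kernelPairing_hasDerivAt_of_support_subset`: **the pairing identity for compactly supported
  test fields** — for `ψ` jointly smooth on an open time set with slices supported in a fixed
  compact set, `d/dt ∫ ψ(t) K(t) = ∫ (∂ₜψ + Dψ·v − νΔψ) K(t)`: transport drops out exactly
  (differentiation under the integral sign `hasDerivAt_integral_of_contDiffOn`, the adjoint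
  equation, the transport integration by parts and the tree's Green identity
  `integral_mul_laplacian_eq_integral_laplacian_mul` of `SlicePressureIdentity`);
* `kernelPairing_gaussian_envelope`: on a compact time window `[a, b]`, `b < T`, a two-sided
  Gaussian-comparable kernel (`IsGaussianComparable`, Aronson 1967) lies below ONE integrable
  Gaussian (only the UPPER bound is used);
* `kernelPairing_tendsto_integral_one_sub_cutoff`: `∫ (1 − χ_{n+1}) g → 0` for integrable `g`
  and the tree's cut-off `cutoff R` (dominated convergence);
* `kernelPairing_isSmoothSpaceTimeOn_mul_cutoff`, `kernelPairing_mul_cutoff_eq_zero`: the cut-off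
  test fields `φ χ_R`;
* `stub_kernelPairing_compactSupport`: the `ℝ³` form of the pairing identity for test fields
  vanishing off a fixed ball — the sub-goal registered on the crux item for this helper file.

The main file `AdaptedFrequencyFrequencyRigidityKernelPairing` removes the cut-off (`R → ∞`,
uniform convergence of the derivatives on compact time windows) and proves the stub.

References: A. Friedman, *Partial Differential Equations of Parabolic Type* (1964), Ch. 1 §8
(the adjoint operator) [Friedman1964]; P. Constantin, G. Iyer, Comm. Pure Appl. Math. 61 (2008),
§2 [ConstantinIyer2007]; L. C. Evans, *PDE* (2010), App. C.2 [Evans2010].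
-/

noncomputable section

namespace Summit.NavierStokesRegularity.NavierStokesRegularity.Theorems.FrequencyRigidity.TwoEndedPinning

open Literature.Analysis.FluidPDE MeasureTheory Set Filter Topology Function
open scoped RealInnerProductSpace Laplacian ContDiff

variable {E : Type*} [NormedAddCommGroup E] [InnerProductSpace ℝ E] [FiniteDimensional ℝ E]
  [MeasurableSpace E] [BorelSpace E]

/-! ### Transport integration by parts against a divergence-free drift -/

/-- **Transport integration by parts.** For `p ∈ C¹_c(E)`, `k ∈ C¹(E)` and a divergence-free
drift `V ∈ C¹(E; E)`: `∫ p · Dk(V) = -∫ Dp(V) · k` (apply the boundary-free divergence theorem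
to the compactly supported field `(p k) V`, whose divergence is `D(pk)(V) + pk div V = D(pk)(V)`;
Evans, *PDE*, App. C.2). [folklore] -/
theorem kernelPairing_integral_mul_fderiv_apply_eq_neg {p k : E → ℝ} {V : E → E}
    (hp : ContDiff ℝ 1 p) (hk : ContDiff ℝ 1 k) (hV : ContDiff ℝ 1 V)
    (hdiv : VectorCalculus.IsDivFree V) (hpc : HasCompactSupport p) :
    ∫ x, p x * fderiv ℝ k x (V x) = -∫ x, fderiv ℝ p x (V x) * k x := by
  -- `θ = p k ∈ C¹_c`, `∫ Dθ(V) = ∫ div (θ V) = 0`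
  have hθ : ContDiff ℝ 1 fun x => p x * k x := hp.mul hk
  have hθc : HasCompactSupport fun x => p x * k x := hpc.mul_right
  have h0 : ∫ x, fderiv ℝ (fun y => p y * k y) x (V x) = 0 := by
    have key : ∀ x, fderiv ℝ (fun y => p y * k y) x (V x) =
        VectorCalculus.divergence (fun y => (p y * k y) • V y) x := fun x => by
      rw [divergence_smul_apply (hθ.differentiable one_ne_zero x)
        (hV.differentiable one_ne_zero x), hdiv x, mul_zero, zero_add, gradient,
        real_inner_comm, InnerProductSpace.toDual_symm_apply]
    simp_rw [key]
    exact integral_divergence_eq_zero (hθ.smul hV) hθc.smul_right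
  -- expand `D(pk)(V) = p Dk(V) + Dp(V) k`
  have hexp : ∀ x, fderiv ℝ (fun y => p y * k y) x (V x) =
      p x * fderiv ℝ k x (V x) + fderiv ℝ p x (V x) * k x := fun x => by
    rw [fderiv_fun_mul (hp.differentiable one_ne_zero x) (hk.differentiable one_ne_zero x)]
    simp only [_root_.add_apply, _root_.FunLike.coe_smul, Pi.smul_apply, smul_eq_mul]
    ring
  simp_rw [hexp] at h0
  have hi₁ : Integrable fun x => p x * fderiv ℝ k x (V x) :=
    (hp.continuous.mul ((hk.continuous_fderiv one_ne_zero).clm_apply hV.continuous))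
      |>.integrable_of_hasCompactSupport hpc.mul_right
  have hi₂ : Integrable fun x => fderiv ℝ p x (V x) * k x := by
    have hc : HasCompactSupport fun x => fderiv ℝ p x (V x) * k x :=
      HasCompactSupport.intro hpc.isCompact fun x hx => by
        rw [fderiv_of_notMem_tsupport ℝ hx]; simp
    exact (((hp.continuous_fderiv one_ne_zero).clm_apply hV.continuous).mul hk.continuous)
      |>.integrable_of_hasCompactSupport hc
  rw [integral_add hi₁ hi₂] at h0
  linarith

/-! ### The adjoint equation at interior times -/

/-- **The adjoint equation with a two-sided time derivative.** At an interior time `t` of the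
time set `S` (`S ∈ 𝓝 t`), an adapted backward kernel `K` of `∂ₜ + v·∇ − νΔ` has the time
derivative `∂ₜK(t, x) = −(DK(t)(x)(v t x) + ν ΔK(t)(x))` (clause (3) of `IsAdaptedBackwardKernel`,
Friedman's adjoint equation `L*Γ* = 0`, with `timeDerivWithin S = deriv` at interior times).
[cite: Friedman1964, Ch. 1 §8 (8.3)] -/
theorem kernelPairing_hasDerivAt_kernel {ν : ℝ} {v : ℝ → E → E} {S : Set ℝ} {T : ℝ} {x₀ : E}
    {K : ℝ → E → ℝ} (hK : IsAdaptedBackwardKernel ν v S T x₀ K) {t : ℝ} (ht : S ∈ 𝓝 t)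
    (x : E) :
    HasDerivAt (fun s => K s x) (-(fderiv ℝ (K t) x (v t x) + ν * (Δ (K t)) x)) t := by
  have ht' : t ∈ S := mem_of_mem_nhds ht
  have h1 := hasDerivAt_timeLine_timeDerivWithin (hK.contDiffOn.of_le one_le_two) ht x
  have h2 := hK.adjoint_eq t ht' x
  refine h1.congr_deriv ?_
  linarith

/-! ### The pairing identity for compactly supported test fields -/

/-- **Kernel pairing identity, compactly supported test fields.** Let `S` be an open time set,
`v` a jointly smooth divergence-free drift on `S`, `K` an adapted backward kernel of
`∂ₜ + v·∇ − νΔ` on `S` (jointly `C²`, adjoint equation `∂ₜK + DK·v + νΔK = 0`), and `ψ` a jointly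
smooth scalar test field whose slices `ψ t`, `t ∈ S`, are supported in a fixed compact set `K₀`.
Then for `t ∈ S` the derivative integrand is integrable and
`d/dt ∫ ψ(t, x) K(t, x) dx = ∫ (∂ₜψ + Dψ·v − νΔψ)(t, x) K(t, x) dx`:
differentiate under the integral sign, substitute the adjoint equation for `∂ₜK`, and integrate
by parts — `∫ ψ DK·v = −∫ Dψ·v K` (`div v = 0`) and `∫ ψ ΔK = ∫ Δψ K` (Green) — so the transport
term drops out exactly (the defining property of the backward stochastic-Lagrangian density,
Constantin–Iyer 2008, §2). [cite: ConstantinIyer2007, §2] -/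
theorem kernelPairing_hasDerivAt_of_support_subset {ν : ℝ} {v : ℝ → E → E} {S : Set ℝ}
    (hS : IsOpen S) {T : ℝ} {x₀ : E} {K ψ : ℝ → E → ℝ} (hv : IsSmoothSpaceTimeOn S v)
    (hdiv : ∀ t ∈ S, VectorCalculus.IsDivFree (v t)) (hK : IsAdaptedBackwardKernel ν v S T x₀ K)
    (hψ : IsSmoothSpaceTimeOn S ψ) {K₀ : Set E} (hK₀ : IsCompact K₀)
    (hsupp : ∀ t ∈ S, ∀ x ∉ K₀, ψ t x = 0) {t : ℝ} (ht : t ∈ S) :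
    Integrable (fun x => (deriv (fun s => ψ s x) t + fderiv ℝ (ψ t) x (v t x)
        - ν * (Δ (ψ t)) x) * K t x) ∧
      HasDerivAt (fun s => ∫ x, ψ s x * K s x)
        (∫ x, (deriv (fun s => ψ s x) t + fderiv ℝ (ψ t) x (v t x) - ν * (Δ (ψ t)) x) * K t x)
        t := by
  have hSt : S ∈ 𝓝 t := hS.mem_nhds ht
  -- regularity of the slices at time `t`
  have hk2 : ContDiff ℝ 2 (K t) := hK.contDiff_slice ht
  have hk1 : ContDiff ℝ 1 (K t) := hk2.of_le one_le_two
  have hp : ContDiff ℝ ∞ (ψ t) := hψ.contDiff_slice ht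
  have hp2 : ContDiff ℝ 2 (ψ t) := contDiff_infty.1 hp 2
  have hp1 : ContDiff ℝ 1 (ψ t) := hp2.of_le one_le_two
  have hV1 : ContDiff ℝ 1 (v t) := contDiff_infty.1 (hv.contDiff_slice ht) 1
  have hpc : HasCompactSupport (ψ t) := HasCompactSupport.intro hK₀ (hsupp t ht)
  -- the time-derivative slice `d = ∂ₜψ(t, ·)`: continuous, supported in `K₀`
  obtain ⟨d, hd⟩ : ∃ d : E → ℝ, d = fun x => deriv (fun s => ψ s x) t := ⟨_, rfl⟩
  have hdc : Continuous d := by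
    rw [hd]; exact ((hψ.isSmoothSpaceTimeOn_deriv hS).contDiff_slice ht).continuous
  have hd0 : ∀ x ∉ K₀, d x = 0 := fun x hx => by
    have h0 : (fun s => ψ s x) =ᶠ[𝓝 t] fun _ => (0 : ℝ) := by
      filter_upwards [hSt] with s hs using hsupp s hs x hx
    rw [hd]
    show deriv (fun s => ψ s x) t = 0
    rw [h0.deriv_eq, deriv_const]
  have hdcs : HasCompactSupport d := HasCompactSupport.intro hK₀ hd0
  -- integrable pairings (continuous, compactly supported)
  have iA : Integrable fun x => d x * K t x :=
    (hdc.mul hk1.continuous).integrable_of_hasCompactSupport hdcs.mul_right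
  have iB : Integrable fun x => ψ t x * fderiv ℝ (K t) x (v t x) :=
    (hp.continuous.mul ((hk1.continuous_fderiv one_ne_zero).clm_apply hV1.continuous))
      |>.integrable_of_hasCompactSupport hpc.mul_right
  have iC : Integrable fun x => ψ t x * (Δ (K t)) x :=
    (hp.continuous.mul (continuous_laplacian hk2)).integrable_of_hasCompactSupport hpc.mul_right
  have iD : Integrable fun x => fderiv ℝ (ψ t) x (v t x) * K t x := by
    have hc : HasCompactSupport fun x => fderiv ℝ (ψ t) x (v t x) * K t x :=
      HasCompactSupport.intro hpc.isCompact fun x hx => by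
        rw [fderiv_of_notMem_tsupport ℝ hx]; simp
    exact (((hp1.continuous_fderiv one_ne_zero).clm_apply hV1.continuous).mul hk1.continuous)
      |>.integrable_of_hasCompactSupport hc
  have iE : Integrable fun x => (Δ (ψ t)) x * K t x := by
    have hc : HasCompactSupport fun x => (Δ (ψ t)) x * K t x :=
      HasCompactSupport.intro hpc.isCompact fun x hx => by
        rw [laplacian_eq_zero_of_notMem_tsupport hx, zero_mul]
    exact ((continuous_laplacian hp2).mul hk1.continuous).integrable_of_hasCompactSupport hc
  have iAD : Integrable fun x => d x * K t x + fderiv ℝ (ψ t) x (v t x) * K t x := iA.add iD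
  have iEν : Integrable fun x => ν * ((Δ (ψ t)) x * K t x) := iE.const_mul ν
  have iAB : Integrable fun x => d x * K t x - ψ t x * fderiv ℝ (K t) x (v t x) := iA.sub iB
  have iCν : Integrable fun x => ν * (ψ t x * (Δ (K t)) x) := iC.const_mul ν
  -- the target integrand, split
  have hsplit : ∫ x, (deriv (fun s => ψ s x) t + fderiv ℝ (ψ t) x (v t x) - ν * (Δ (ψ t)) x)
      * K t x = (∫ x, d x * K t x) + (∫ x, fderiv ℝ (ψ t) x (v t x) * K t x)
        - ν * ∫ x, (Δ (ψ t)) x * K t x := by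
    have heq : ∀ x, (deriv (fun s => ψ s x) t + fderiv ℝ (ψ t) x (v t x) - ν * (Δ (ψ t)) x)
        * K t x = d x * K t x + fderiv ℝ (ψ t) x (v t x) * K t x
          - ν * ((Δ (ψ t)) x * K t x) := fun x => by
      rw [hd]; ring
    simp_rw [heq]
    rw [integral_sub iAD iEν, integral_add iA iD, integral_const_mul]
  refine ⟨?_, ?_⟩
  · have heq : (fun x => (deriv (fun s => ψ s x) t + fderiv ℝ (ψ t) x (v t x)
        - ν * (Δ (ψ t)) x) * K t x) = fun x => d x * K t x + fderiv ℝ (ψ t) x (v t x) * K t x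
          - ν * ((Δ (ψ t)) x * K t x) := by
      funext x; rw [hd]; ring
    rw [heq]
    exact iAD.sub iEν
  -- Step 1: differentiate under the integral sign
  have hΦ : ContDiffOn ℝ 1 (uncurry fun s x => ψ s x * K s x) (S ×ˢ univ) :=
    (contDiffOn_infty.1 hψ 1).mul (hK.contDiffOn.of_le one_le_two)
  have hΦsupp : ∀ s ∈ S, ∀ x ∉ K₀, ψ s x * K s x = 0 := fun s hs x hx => by
    rw [hsupp s hs x hx, zero_mul]
  have step1 := hasDerivAt_integral_of_contDiffOn (μ := volume) hS hΦ hK₀ hΦsupp ht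
  -- Step 2: the pointwise time derivative through the adjoint equation
  have hderiv : ∀ x, deriv (fun s => ψ s x * K s x) t =
      d x * K t x + ψ t x * -(fderiv ℝ (K t) x (v t x) + ν * (Δ (K t)) x) := fun x => by
    rw [hd]
    exact ((hψ.hasDerivAt_timeLine hS ht x).mul (kernelPairing_hasDerivAt_kernel hK hSt x)).deriv
  refine step1.congr_deriv ?_
  -- Step 3: integrate by parts
  have hibp1 := kernelPairing_integral_mul_fderiv_apply_eq_neg hp1 hk1 hV1 (hdiv t ht) hpc
  have hibp2 : ∫ x, ψ t x * (Δ (K t)) x = ∫ x, (Δ (ψ t)) x * K t x :=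
    calc ∫ x, ψ t x * (Δ (K t)) x = ∫ x, (Δ (K t)) x * ψ t x :=
          integral_congr_ae (Eventually.of_forall fun x => mul_comm _ _)
      _ = ∫ x, K t x * (Δ (ψ t)) x :=
          (integral_mul_laplacian_eq_integral_laplacian_mul hk2 hp2 hpc).symm
      _ = ∫ x, (Δ (ψ t)) x * K t x := integral_congr_ae (Eventually.of_forall fun x => mul_comm _ _)
  calc ∫ x, deriv (fun s => ψ s x * K s x) t
      = ∫ x, (d x * K t x - ψ t x * fderiv ℝ (K t) x (v t x)
          - ν * (ψ t x * (Δ (K t)) x)) :=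
        integral_congr_ae (Eventually.of_forall fun x => by beta_reduce; rw [hderiv x]; ring)
    _ = (∫ x, d x * K t x) - (∫ x, ψ t x * fderiv ℝ (K t) x (v t x))
          - ν * ∫ x, ψ t x * (Δ (K t)) x := by
        rw [integral_sub iAB iCν, integral_sub iA iB, integral_const_mul]
    _ = (∫ x, d x * K t x) + (∫ x, fderiv ℝ (ψ t) x (v t x) * K t x)
          - ν * ∫ x, (Δ (ψ t)) x * K t x := by rw [hibp1, hibp2]; ring
    _ = _ := hsplit.symm

/-! ### Cut-off test fields -/

omit [FiniteDimensional ℝ E] [MeasurableSpace E] [BorelSpace E] in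
/-- The cut-off test field `(t, x) ↦ φ(t, x) χ_R(x)` of a jointly smooth `φ` is jointly smooth
(`cutoff R` is smooth and time independent). [folklore] -/
theorem kernelPairing_isSmoothSpaceTimeOn_mul_cutoff {S : Set ℝ} {φ : ℝ → E → ℝ}
    (hφ : IsSmoothSpaceTimeOn S φ) (R : ℝ) :
    IsSmoothSpaceTimeOn S fun t x => φ t x * cutoff R x :=
  hφ.mul (isSmoothSpaceTimeOn_const_time (contDiff_cutoff R) S)

omit [FiniteDimensional ℝ E] [MeasurableSpace E] [BorelSpace E] in
/-- The slices of the cut-off test field vanish off the closed ball of radius `2R` (`R > 0`).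
[folklore] -/
theorem kernelPairing_mul_cutoff_eq_zero {φ : ℝ → E → ℝ} {R : ℝ} (hR : 0 < R) (t : ℝ) (x : E)
    (hx : x ∉ Metric.closedBall (0 : E) (2 * R)) : φ t x * cutoff R x = 0 := by
  rw [Metric.mem_closedBall, dist_zero_right, not_le] at hx
  rw [cutoff_eq_zero hR hx.le, mul_zero]

/-! ### The Gaussian envelope on a compact time window -/

/-- Gaussians `x ↦ exp (−β ‖x‖²)`, `β > 0`, are integrable on `E` (their integral is the
positive number `(π/β)^{dim E/2}`, Mathlib `GaussianFourier.integral_rexp_neg_mul_sq_norm`).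
[folklore] -/
theorem kernelPairing_integrable_exp_neg_mul_sq_norm {β : ℝ} (hβ : 0 < β) :
    Integrable fun x : E => Real.exp (-β * ‖x‖ ^ 2) := by
  by_contra h
  have h1 := GaussianFourier.integral_rexp_neg_mul_sq_norm (V := E) hβ
  rw [integral_undef h] at h1
  have : 0 < (Real.pi / β) ^ ((Module.finrank ℝ E : ℝ) / 2) := by positivity
  exact this.ne h1

/-- **One Gaussian envelope on a compact time window (upper Aronson bound only).** If `K` is
two-sided Gaussian-comparable on `S` about the pole `(T, x₀)` and `[a, b] ⊆ S` with `b < T`,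
then there is an integrable `g ≥ 0` with `K(s, x) ≤ g(x)` for all `s ∈ [a, b]` and all `x`:
`g(x) = C₁ (T − b)^{−n/2} exp(−‖x − x₀‖²/(C₂ (T − a)))` (both factors of the upper bound are
monotone in `s`). [cite: Aronson1967, Thm 1] -/
theorem kernelPairing_gaussian_envelope {K : ℝ → E → ℝ} {S : Set ℝ} {T : ℝ} {x₀ : E}
    (hG : IsGaussianComparable K S T x₀) {a b : ℝ} (hab : a ≤ b) (hb : b < T)
    (hS : Icc a b ⊆ S) :
    ∃ g : E → ℝ, Integrable g ∧ (∀ x, 0 ≤ g x) ∧ ∀ s ∈ Icc a b, ∀ x, K s x ≤ g x := by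
  obtain ⟨c₁, c₂, C₁, C₂, -, -, hC₁, hC₂, h⟩ := hG
  set n : ℝ := (Module.finrank ℝ E : ℝ) with hn
  have hTb : 0 < T - b := sub_pos.2 hb
  have hTa : 0 < T - a := by linarith
  refine ⟨fun x => C₁ * (T - b) ^ (-n / 2) * Real.exp (-(‖x - x₀‖ ^ 2) / (C₂ * (T - a))),
    ?_, fun x => by positivity, fun s hs x => ?_⟩
  · -- integrability: a translated Gaussian
    have hβ : 0 < 1 / (C₂ * (T - a)) := by positivity
    have h1 := ((kernelPairing_integrable_exp_neg_mul_sq_norm (E := E) hβ).comp_sub_right x₀)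
      |>.const_mul (C₁ * (T - b) ^ (-n / 2))
    refine h1.congr (Eventually.of_forall fun x => ?_)
    simp only
    congr 2
    ring
  · have hs' : s ∈ S := hS hs
    have hTs : 0 < T - s := by linarith [hs.2]
    refine ((h s hs' x).2).trans ?_
    have hn0 : -n / 2 ≤ 0 := by
      have : 0 ≤ n := by rw [hn]; exact Nat.cast_nonneg _
      linarith
    have e1 : (T - s) ^ (-n / 2) ≤ (T - b) ^ (-n / 2) :=
      Real.rpow_le_rpow_of_nonpos hTb (by linarith [hs.2]) hn0
    have e2 : Real.exp (-(‖x - x₀‖ ^ 2) / (C₂ * (T - s))) ≤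
        Real.exp (-(‖x - x₀‖ ^ 2) / (C₂ * (T - a))) := by
      rw [Real.exp_le_exp, neg_div, neg_div, neg_le_neg_iff]
      exact div_le_div_of_nonneg_left (sq_nonneg _) (by positivity)
        (mul_le_mul_of_nonneg_left (by linarith [hs.1]) hC₂.le)
    show _ ≤ C₁ * (T - b) ^ (-n / 2) * Real.exp (-(‖x - x₀‖ ^ 2) / (C₂ * (T - a)))
    refine mul_le_mul (mul_le_mul_of_nonneg_left e1 hC₁.le) e2 (Real.exp_pos _).le ?_
    exact mul_nonneg hC₁.le (Real.rpow_nonneg hTb.le _)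

/-! ### Removing the cut-off: the tail integral -/

/-- **The tail of an integrable function against the cut-off vanishes**: for integrable `g`,
`∫ (1 − χ_{n+1}(x)) g(x) dx → 0` as `n → ∞` (dominated convergence: `0 ≤ 1 − χ ≤ 1` and
`χ_{n+1}(x) → 1` at every `x`). [folklore] -/
theorem kernelPairing_tendsto_integral_one_sub_cutoff {g : E → ℝ} (hg : Integrable g) :
    Tendsto (fun n : ℕ => ∫ x, (1 - cutoff ((n : ℝ) + 1) x) * g x) atTop (𝓝 0) := by
  have h := tendsto_integral_of_dominated_convergence
    (F := fun (n : ℕ) x => (1 - cutoff ((n : ℝ) + 1) x) * g x) (f := fun _ => (0 : ℝ))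
    (μ := volume) (fun x => ‖g x‖) ?_ hg.norm ?_ ?_
  · simpa using h
  · intro n
    exact ((continuous_const.sub (contDiff_cutoff (n := 0) _).continuous).aestronglyMeasurable).mul
      hg.aestronglyMeasurable
  · intro n
    refine Eventually.of_forall fun x => ?_
    rw [norm_mul]
    refine mul_le_of_le_one_left (norm_nonneg _) ?_
    rw [Real.norm_eq_abs, abs_le]
    constructor <;> linarith [cutoff_nonneg ((n : ℝ) + 1) x, cutoff_le_one ((n : ℝ) + 1) x]
  · refine Eventually.of_forall fun x => ?_
    have := ((tendsto_cutoff_natCast_add_one x).const_sub 1).mul_const (g x)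
    simpa using this

/-! ### The registered sub-goal: the stub for compactly supported test fields on `ℝ³` -/

/-- **Sub-goal `stub_kernelPairing_compactSupport` (registered on the crux item; file 1 of 2 of
stub `stub_kernelPairing`).** The kernel pairing identity on `ℝ³ × (−∞, 0)` for a jointly smooth
test field `ψ` whose slices vanish off a fixed ball `B̄(0, R)`: for a jointly smooth
divergence-free drift `v` and an adapted backward kernel `K` of `∂ₜ + v·∇ − νΔ` with pole `(0, 0)`,
`d/dt ∫ ψ(t) K(t) = ∫ (∂ₜψ + Dψ·v − νΔψ)(t) K(t)` at every `t < 0`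
(`kernelPairing_hasDerivAt_of_support_subset`). The main file removes the cut-off.
[cite: ConstantinIyer2007, §2] -/
theorem stub_kernelPairing_compactSupport :
  ∀ (ν : ℝ) (v : ℝ → EuclideanSpace ℝ (Fin 3) → EuclideanSpace ℝ (Fin 3))
    (K ψ : ℝ → EuclideanSpace ℝ (Fin 3) → ℝ) (R : ℝ),
    Literature.Analysis.FluidPDE.IsSmoothSpaceTimeOn (Set.Iio 0) v →
    (∀ t ∈ Set.Iio (0 : ℝ), Literature.Analysis.FluidPDE.VectorCalculus.IsDivFree (v t)) →
    Literature.Analysis.FluidPDE.IsAdaptedBackwardKernel ν v (Set.Iio 0) 0 0 K →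
    Literature.Analysis.FluidPDE.IsSmoothSpaceTimeOn (Set.Iio 0) ψ →
    (∀ t ∈ Set.Iio (0 : ℝ), ∀ x : EuclideanSpace ℝ (Fin 3),
        x ∉ Metric.closedBall (0 : EuclideanSpace ℝ (Fin 3)) R → ψ t x = 0) →
    ∀ t : ℝ, t < 0 →
      HasDerivAt (fun s => ∫ x, ψ s x * K s x)
        (∫ x, (deriv (fun s => ψ s x) t + fderiv ℝ (ψ t) x (v t x)
                - ν * Laplacian.laplacian (ψ t) x) * K t x) t := by
  intro ν v K ψ R hv hdiv hK hψ hsupp t ht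
  exact (kernelPairing_hasDerivAt_of_support_subset isOpen_Iio hv hdiv hK hψ
    (isCompact_closedBall (0 : EuclideanSpace ℝ (Fin 3)) R) (fun s hs x hx => hsupp s hs x hx) ht).2

end Summit.NavierStokesRegularity.NavierStokesRegularity.Theorems.FrequencyRigidity.TwoEndedPinning

end
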